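import Mathlib
import Literature.Analysis.FluidPDE.Tao2016AveragedNS.RenormalisedCascadeWaves
import Summits.NavierStokesRegularity.NavierStokesRegularity.Theorems.TaoLadderRungTwoBreakNoSurvivingEternalViscBddOneContinuumCharacteristic

/-!
# Crux `TaoLadderRungTwoBreak.NoSurvivingEternalViscBddOne` (stmt-NavierStokesRegularity-20419), remaining lemma (W1) on the
# WHOLE class `E₂(R)`: sonic selection for SYSTEMS of conservation laws — the Kolmogorov exponent `a = 1` survives every
# multi-invariant continuum limit except on the branch «left sonic eigenvector ⊥ profile» (kernel anchor for the census of 4-g12)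

MODEL/heuristic layer only (elementary linear algebra); nothing here is a statement about the Navier–Stokes equations or about
the lattice items; `--supports stmt-NavierStokesRegularity-20419`.

`…ContinuumCharacteristic` (hands 4-g9/4-g11) pinned the similarity exponents `(a, b) = (1, 3/2)` of shock-free continuum
blow-up fronts of the SCALAR law `∂_τE + ∂_y(2e^{y}E^{3/2}) = 0` (continuum limit of the dyadic member) by regularity at the
sonic point, hence the Kolmogorov wake rate `a/b = 2/3` against the (S₁) threshold `2/5`.  A four-mode table of `E₂(R)` whose
intra-shell dynamics has SEVERAL slow invariants (a second conserved quadratic quantity, helicity-like, as in the GOY/Sabra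
models where self-similar blow-up is anomalous) has as smooth-regime continuum limit a SYSTEM `∂_τ𝐄 + ∂_y(e^{y}Φ(𝐄)) = 0`,
`Φ : V → V` homogeneous of degree `p` (`p = 3/2` for Tao's quadratic couplings).  Similarity fronts
`𝐄 = (t⋆−τ)^{a}G(η)`, `η = y + b·log(t⋆−τ)`, need the flux balance `b = 1 + (p−1)a` and the steady profile system
`(e^{η}DΦ(G) − b)G' = aG − e^{η}Φ(G)`.  At a SONIC point (`b` an eigenvalue of `M = e^{η}DΦ(G)`, left eigenvector `ℓ`)
solvability of the profile system and Euler's identity `DΦ(G)G = pΦ(G)` give (`sonic_alternative`)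

  **`(a − b/p)·ℓ(G) = 0`** — either the scalar (Kolmogorov) selection `a = b/p` (with the balance: `a = 1`, `b = p`,
  wake rate `1/p = 2/3`; `kolmogorov_branch`), or the profile is ANNIHILATED by the sonic left eigenvector, `ℓ(G) = 0`.

READING for ⟨20419⟩ (census 4-g12, item (L3)(b)): within entropy (sonic-regular) continuum fronts, a table of `E₂(R)` can escape
the Kolmogorov exponent `a = 1` — and only then reach the surviving range `a ≤ 1/2` (`…ContinuumCharacteristic`, lattice
dictionary) — ONLY through a multi-invariant continuum limit whose similarity profile hits the sonic manifold orthogonally to the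
sonic left eigenvector; for a scalar limit (`ℓ(G) = ℓ·G ≠ 0` automatically when `G > 0`) there is no escape.  This is the
precise place where a four-mode rotating / two-invariant table could beat the dyadic member; it is a finite-dimensional ODE
shooting problem per table, not a lattice computation.  HONEST LABEL: linear algebra about a heuristic continuum limit; proves
nothing about any item; (ρ0), (ρ+), ⟨20419⟩ and every NS statement remain OPEN; rung 0.
-/

noncomputable section

-- the summit and its single sub-problem share the name (CONVENTIONS §1)
set_option linter.dupNamespace false

namespace Summit.NavierStokesRegularity.NavierStokesRegularity.Theorems.NoSurvivingEternalViscBddOne.ContinuumSystem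

variable {V : Type*} [AddCommGroup V] [Module ℝ V]

/-- **Sonic alternative for systems.**  Let `M : V → V` be linear (the frozen Jacobian `e^{η}DΦ(G)` at a point of the profile),
`Φ, G, G' ∈ V`, `p ≠ 0`, with Euler's identity `M G = p•Φ` (homogeneity of degree `p` of the flux), the steady profile system
`M G' − b•G' = a•G − Φ`, and a LEFT eigenvector `ℓ` of `M` for the eigenvalue `b` (`ℓ ∘ M = b·ℓ`: the point is sonic for the
frame speed `b`).  Then `(a − b/p)·ℓ(G) = 0`.
[folklore (self-similar solutions of the second kind for systems of conservation laws, cf. Barenblatt 1979 Ch. 4); cell census 4-g12 (continuum limit of multi-invariant tables)] -/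
theorem sonic_alternative (M : V →ₗ[ℝ] V) (ℓ : V →ₗ[ℝ] ℝ) {Φ G G' : V} {a b p : ℝ} (hp : p ≠ 0)
    (hEuler : M G = p • Φ) (hprofile : M G' - b • G' = a • G - Φ) (hleft : ∀ v : V, ℓ (M v) = b * ℓ v) :
    (a - b / p) * ℓ G = 0 := by
  -- apply `ℓ` to the profile system: the left-hand side dies, so `a·ℓ(G) = ℓ(Φ)`
  have h1 : ℓ (M G' - b • G') = ℓ (a • G - Φ) := by rw [hprofile]
  rw [map_sub, map_sub, map_smul, map_smul, hleft G', smul_eq_mul, smul_eq_mul] at h1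
  -- Euler: `ℓ(Φ) = (1/p)·ℓ(M G) = (b/p)·ℓ(G)`
  have h2 : ℓ (M G) = p * ℓ Φ := by rw [hEuler, map_smul, smul_eq_mul]
  rw [hleft G] at h2
  have h3 : ℓ Φ = b / p * ℓ G := by field_simp; linarith
  have h4 : a * ℓ G - ℓ Φ = 0 := by linarith
  rw [h3] at h4
  linarith

/-- **The Kolmogorov branch.**  If the profile is NOT annihilated by the sonic left eigenvector (`ℓ(G) ≠ 0`), the sonic point
selects `a = b/p`; with the flux balance `b = 1 + (p−1)a` of the similarity class this is `a = 1`, `b = p`, wake rate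
`a/b = 1/p` — for Tao's quadratic couplings `p = 3/2`: `(a, b) = (1, 3/2)`, wake rate `2/3`, the scalar selection of
`…ContinuumCharacteristic.exponents_of_sonic_selection`, whatever the number of slow invariants.
[folklore (self-similar solutions of the second kind); cell census 4-g12] -/
theorem kolmogorov_branch (M : V →ₗ[ℝ] V) (ℓ : V →ₗ[ℝ] ℝ) {Φ G G' : V} {a b p : ℝ} (hp : p ≠ 0)
    (hEuler : M G = p • Φ) (hprofile : M G' - b • G' = a • G - Φ) (hleft : ∀ v : V, ℓ (M v) = b * ℓ v)
    (hG : ℓ G ≠ 0) (hbal : b = 1 + (p - 1) * a) : a = 1 ∧ b = p ∧ a / b = 1 / p := by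
  have h := sonic_alternative M ℓ hp hEuler hprofile hleft
  have hab : a = b / p := by
    have := mul_eq_zero.1 h
    rcases this with h0 | h0
    · linarith
    · exact absurd h0 hG
  have ha : a = 1 := by
    rw [hbal] at hab
    field_simp at hab
    nlinarith [hab]
  have hb : b = p := by rw [hbal, ha]; ring
  refine ⟨ha, hb, ?_⟩
  rw [ha, hb]

/-- **The scalar case is the Kolmogorov branch.**  For `V = ℝ`, `M = multiplication by 3e^{η}√G` (the characteristic speed of
the flux `2e^{y}E^{3/2}`, `p = 3/2`), a positive profile value is never annihilated by a non-zero functional, so at a sonic point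
`3e^{η}√G = b` one gets `a = 2b/3` — the statement `…ContinuumCharacteristic.sonic_selection`, here as an instance of the
system alternative.
[folklore (self-similar solutions of the second kind); cell memo W1 / census 4-g12] -/
theorem scalar_sonic_selection_of_alternative {Gv G'v a b η : ℝ} (hpos : 0 < Gv)
    (hprofile : (3 * Real.exp η * Real.sqrt Gv) * G'v - b * G'v = a * Gv - 2 * Real.exp η * (Gv * Real.sqrt Gv))
    (hsonic : 3 * Real.exp η * Real.sqrt Gv = b) : a = 2 * b / 3 := by
  -- `M = (3e^{η}√G)·`, `Φ = 2e^{η}G√G`, `p = 3/2`, `ℓ = id`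
  set c : ℝ := 3 * Real.exp η * Real.sqrt Gv with hc
  have hEuler : (c • LinearMap.id : ℝ →ₗ[ℝ] ℝ) Gv = (3 / 2 : ℝ) • (2 * Real.exp η * (Gv * Real.sqrt Gv)) := by
    simp only [LinearMap.smul_apply, LinearMap.id_apply, smul_eq_mul, hc]; ring
  have hprof : (c • LinearMap.id : ℝ →ₗ[ℝ] ℝ) G'v - b • G'v = a • Gv - 2 * Real.exp η * (Gv * Real.sqrt Gv) := by
    simp only [LinearMap.smul_apply, LinearMap.id_apply, smul_eq_mul]; exact hprofile
  have hleft : ∀ v : ℝ, (LinearMap.id : ℝ →ₗ[ℝ] ℝ) ((c • LinearMap.id : ℝ →ₗ[ℝ] ℝ) v)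
      = b * (LinearMap.id : ℝ →ₗ[ℝ] ℝ) v := by
    intro v; simp only [LinearMap.smul_apply, LinearMap.id_apply, smul_eq_mul]; rw [hsonic]
  have h := sonic_alternative (c • LinearMap.id) LinearMap.id (by norm_num : (3 / 2 : ℝ) ≠ 0) hEuler hprof hleft
  simp only [LinearMap.id_apply] at h
  rcases mul_eq_zero.1 h with h0 | h0
  · linarith
  · exact absurd h0 hpos.ne'

end Summit.NavierStokesRegularity.NavierStokesRegularity.Theorems.NoSurvivingEternalViscBddOne.ContinuumSystem

end
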